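import Summits.QuantumFields.YangMills.Theorems.UnitScaleGibbsTemporalGaugePrimitiveTorus
import HarnessLib

/-!
# `UnitScaleGibbsChartPairingDictionary` — TORUS PLAQUETTE PAIRINGS READ ON `ℤ^d`: `Σ_p w_p·f_p = ½·Σ_{z∈box}Σ_μΣ_ν W(z,μ,ν)·F(z,μ,ν)` FOR THE
# ANTISYMMETRISED READ-OUTS (KNIT-E2a dictionary of the `stub_linTest` v3.2 plan; LINE 28 «GrossTransfer», crux `UnitScaleTilt.HistoryTailL`
# stmt-QuantumFields-19936 ∕ `MeanDeviationL` stmt-QuantumFields-23083)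

Cell `ym3-torus` (YM ladder rung R3 — NOT d = 4, NOT infinite volume, NOT a mass gap, NOT Clay), width seat `ym-ust-19936-w2` (gen 15), pen of record.
The (Z-a…e) identities are written with ORDERED double sums `Σ_μ Σ_ν` of antisymmetric arrays on `ℤ^d`; the torus side (P-LOC, LIN-ID, X-KNIT-L) sums over
plaquettes `p : Plaq P 0` (`p.μ < p.ν`).  THIS FILE: §1 `sum_sum_eq_two_mul_sum_lt` — for arrays `A, B : Fin d → Fin d → ℝ` with `A` antisymmetric and `B`
antisymmetric, `Σ_μΣ_ν A μ ν·B μ ν = 2·Σ_{(μ,ν), μ<ν} A μ ν·B μ ν`; §2 ★`sum_plaq_mul_eq_half_sum_box` — with ✓w5 `sum_plaq_eq_sum_box`: a torus pairing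
`Σ_p w p·f p` with `w` vanishing off `boxPlaqs lo hi` equals `½·Σ_{z ∈ box}Σ_μΣ_ν W z μ ν·F z μ ν` for the antisymmetrised read-outs
`W z μ ν = w⟨castSite z,μ,ν⟩` (`μ<ν`), `= −w⟨castSite z,ν,μ⟩` (`ν<μ`), `= 0` (`μ=ν`), likewise `F`.
HONEST FRAMING.  Finite-sum bookkeeping; `--supports` helper; proves no stub, crux, rung or summit statement; the Yang–Mills mass gap is NOT proved.
References: [Balaban1985BackgroundPropagators] (3.100) p.413 (box read-outs); [GrossCMP1983] Thm 2.2.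
-/

noncomputable section

set_option autoImplicit false

open scoped BigOperators
open Finset
open Literature.MathematicalPhysics.QuantumFieldTheory.Balaban1983to89
open Literature.MathematicalPhysics.QuantumFieldTheory.Balaban1983to89.T4AxialGaugeSmallField (boxPlaqs castSite)
open Summit.QuantumFields.YangMills.Theorems.UnitScaleGibbsTemporalGaugePrimitiveTorus (sum_plaq_eq_sum_box)

namespace Summit.QuantumFields.YangMills.Theorems.UnitScaleGibbsChartPairingDictionary

/-! ## §1 Ordered double sums of antisymmetric arrays -/

/-- ★ For antisymmetric `A` and `B` (`A ν μ = −A μ ν`, `B ν μ = −B μ ν`): `Σ_μΣ_ν A μ ν·B μ ν = 2·Σ_{q : μ<ν} A q.1 q.2·B q.1 q.2`. [folklore] -/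
theorem sum_sum_eq_two_mul_sum_lt {d : ℕ} (A B : Fin d → Fin d → ℝ) (hA : ∀ μ ν, A ν μ = -A μ ν) (hB : ∀ μ ν, B ν μ = -B μ ν) :
    ∑ μ, ∑ ν, A μ ν * B μ ν = 2 * ∑ q : {q : Fin d × Fin d // q.1 < q.2}, A q.1.1 q.1.2 * B q.1.1 q.1.2 := by
  classical
  -- diagonal terms vanish
  have hdiag : ∀ μ, A μ μ * B μ μ = 0 := fun μ => by
    have h := hA μ μ
    have : A μ μ = 0 := by linarith
    rw [this, zero_mul]
  -- write the double sum over the product type and split `univ = {<} ∪ {=} ∪ {>}`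
  rw [← Finset.sum_product' (s := Finset.univ) (t := Finset.univ) (f := fun μ ν => A μ ν * B μ ν), Finset.univ_product_univ]
  set g : Fin d × Fin d → ℝ := fun q => A q.1 q.2 * B q.1 q.2 with hg
  have hsplit : (Finset.univ : Finset (Fin d × Fin d)) =
      (Finset.univ.filter fun q : Fin d × Fin d => q.1 < q.2) ∪ (Finset.univ.filter fun q : Fin d × Fin d => q.1 = q.2) ∪
        (Finset.univ.filter fun q : Fin d × Fin d => q.2 < q.1) := by
    ext q
    simp only [Finset.mem_univ, Finset.mem_union, Finset.mem_filter, true_and, true_iff]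
    rcases lt_trichotomy q.1 q.2 with h | h | h
    · exact Or.inl (Or.inl h)
    · exact Or.inl (Or.inr h)
    · exact Or.inr h
  have hd12 : Disjoint (Finset.univ.filter fun q : Fin d × Fin d => q.1 < q.2) (Finset.univ.filter fun q : Fin d × Fin d => q.1 = q.2) := by
    rw [Finset.disjoint_filter]; intro q _ h1 h2; exact absurd h2 (ne_of_lt h1)
  have hd3 : Disjoint ((Finset.univ.filter fun q : Fin d × Fin d => q.1 < q.2) ∪ (Finset.univ.filter fun q : Fin d × Fin d => q.1 = q.2))
      (Finset.univ.filter fun q : Fin d × Fin d => q.2 < q.1) := by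
    rw [Finset.disjoint_union_left, Finset.disjoint_filter, Finset.disjoint_filter]
    exact ⟨fun q _ h1 h2 => absurd (h1.trans h2) (lt_irrefl _), fun q _ h1 h2 => absurd (h1 ▸ h2) (lt_irrefl _)⟩
  rw [hsplit, Finset.sum_union hd3, Finset.sum_union hd12]
  -- the diagonal part vanishes
  have hzero : ∑ q ∈ Finset.univ.filter (fun q : Fin d × Fin d => q.1 = q.2), g q = 0 := by
    refine Finset.sum_eq_zero fun q hq => ?_
    rw [Finset.mem_filter] at hq
    obtain ⟨a, b⟩ := q
    simp only at hq
    rw [hg]; simp only [hq.2, hdiag]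
  -- the lower part equals the upper part by the swap
  have hswap : ∑ q ∈ Finset.univ.filter (fun q : Fin d × Fin d => q.2 < q.1), g q =
      ∑ q ∈ Finset.univ.filter (fun q : Fin d × Fin d => q.1 < q.2), g q := by
    refine Finset.sum_nbij' (fun q => (q.2, q.1)) (fun q => (q.2, q.1)) ?_ ?_ ?_ ?_ ?_
    · intro q hq; rw [Finset.mem_filter] at hq ⊢; exact ⟨Finset.mem_univ _, hq.2⟩
    · intro q hq; rw [Finset.mem_filter] at hq ⊢; exact ⟨Finset.mem_univ _, hq.2⟩
    · intro q _; rfl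
    · intro q _; rfl
    · intro q _; rw [hg]; simp only; rw [hA q.2 q.1, hB q.2 q.1]; ring
  -- the upper part as a sum over the subtype
  have hsub : ∑ q ∈ Finset.univ.filter (fun q : Fin d × Fin d => q.1 < q.2), g q = ∑ q : {q : Fin d × Fin d // q.1 < q.2}, g q.1 :=
    Finset.sum_subtype (Finset.univ.filter fun q : Fin d × Fin d => q.1 < q.2) (fun q => by simp) g
  rw [hzero, add_zero, hswap, hsub]
  ring

/-! ## §2 Torus plaquette pairings read on the integer box -/

variable {P : Params} {j : ℕ}

/-- ★ **THE PAIRING DICTIONARY**: for `w, f : Plaq P j → ℝ` with `w` vanishing off `boxPlaqs lo hi` (`hi − lo < sitesPerDir j`), and the antisymmetrised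
read-outs `W F : (Fin P.d → ℤ) → Fin P.d → Fin P.d → ℝ` (`W z μ ν = w ⟨castSite z, μ, ν⟩` for `μ < ν`, antisymmetric, zero diagonal; likewise `F`):
`Σ_p w p·f p = ½·Σ_{z ∈ box} Σ_μ Σ_ν W z μ ν·F z μ ν`. [cite: Balaban1985BackgroundPropagators, (3.100) p.413] -/
theorem sum_plaq_mul_eq_half_sum_box {lo hi : Fin P.d → ℤ} (hN : ∀ κ, hi κ - lo κ < P.sitesPerDir j)
    (w f : Plaq P j → ℝ) (hw : ∀ p, w p ≠ 0 → p ∈ boxPlaqs lo hi)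
    (W F : (Fin P.d → ℤ) → Fin P.d → Fin P.d → ℝ)
    (hW : ∀ z (μ ν : Fin P.d) (h : μ < ν), W z μ ν = w ⟨castSite z, μ, ν, h⟩) (hWa : ∀ z μ ν, W z ν μ = -W z μ ν)
    (hF : ∀ z (μ ν : Fin P.d) (h : μ < ν), F z μ ν = f ⟨castSite z, μ, ν, h⟩) (hFa : ∀ z μ ν, F z ν μ = -F z μ ν) :
    ∑ p : Plaq P j, w p * f p =
      (1 / 2) * ∑ z ∈ Fintype.piFinset (fun i => Finset.Icc (lo i) (hi i)), ∑ μ, ∑ ν, W z μ ν * F z μ ν := by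
  rw [sum_plaq_eq_sum_box hN (fun p => w p * f p) (fun p hp => hw p (left_ne_zero_of_mul hp)), Finset.mul_sum]
  refine Finset.sum_congr rfl fun z _ => ?_
  rw [sum_sum_eq_two_mul_sum_lt (W z) (F z) (hWa z) (hFa z)]
  rw [show (1 : ℝ) / 2 * (2 * ∑ q : {q : Fin P.d × Fin P.d // q.1 < q.2}, W z q.1.1 q.1.2 * F z q.1.1 q.1.2) =
    ∑ q : {q : Fin P.d × Fin P.d // q.1 < q.2}, W z q.1.1 q.1.2 * F z q.1.1 q.1.2 by ring]
  exact Finset.sum_congr rfl fun q _ => by rw [hW z q.1.1 q.1.2 q.2, hF z q.1.1 q.1.2 q.2]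

end Summit.QuantumFields.YangMills.Theorems.UnitScaleGibbsChartPairingDictionary

end
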